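import Literature.Combinatorics.Additive.Vosper

/-!
# ω-census (abelian STPP census): position lemmas for progressions in `ℤ/pℤ` (tools for Vosper clashes at prime order)

HONEST FRAMING (pub-omega census; verbatim): lottery ticket; floor = certified bounds/negative ranges.
Census STRUCTURE tools (seat pub-omega-stpp-1 gen 28, 2026-08-28), family (b2); nothing here is progress on `ω`.

After `STPPVosperTightStructure.lean` has turned an N18-tight block at a prime order into arithmetic progressions (`IsAP`, `apFinset` of
`Literature.Combinatorics.Additive.Vosper`), the clash arguments (HOME `pub-omega-stpp-1-g28/VOSPER-CLASH-225.md`) are integer bookkeeping about a SHORT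
progression sitting inside a LONGER one.  This file proves the two reusable facts, for `p` prime and windows of length `ℓ` with `2ℓ ≤ p + 1` (no wrap-around):

* `exists_int_mul_of_apFinset_subset` — **a progression inside a progression has a small commensurable step**: if `{a + s•f : s < m} ⊆ {b + t•g : t < ℓ}` with
  `f, g ≠ 0`, `m ≥ 2`, `2ℓ ≤ p + 1`, then `f = j·g` for an integer `j ≠ 0` with `(m − 1)·|j| ≤ ℓ − 1` (the positions `t` of consecutive terms differ by the SAME
  integer `j`, because two candidates differ by a multiple of `p` of absolute value `≤ 2ℓ − 2 < p`);
* `eq_or_eq_neg_of_mutual_apFinset_subset` — **mutual containment forces equal steps up to sign**: if moreover `{a′ + s•g : s < m} ⊆ {b′ + t•f : t < ℓ}` and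
  `(ℓ − 1)² < (m − 1)²·(p − 1)`, then `f = g ∨ f = −g` (`f = j·g`, `g = j′·f`, `jj′ ≡ 1 (mod p)` with `|jj′| < p − 1`).

References: M. B. Nathanson, *Additive Number Theory: Inverse Problems*, GTM 165, §2.5 (progressions in `ℤ/pℤ`); used with Vosper's theorem (tree
`Literature.Combinatorics.Additive.vosper_inverse`).
-/

open Finset

namespace Summit.MatrixMultiplication.OmegaCensus.CubeNB

open Literature.Combinatorics.Additive

variable {p : ℕ} [hp : Fact p.Prime]

/-- An integer of absolute value `< p` that vanishes in `ℤ/pℤ` is zero. [folklore] -/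
theorem int_eq_zero_of_cast_eq_zero {z : ℤ} (hz : z.natAbs < p) (h : (z : ZMod p) = 0) : z = 0 := by
  rw [ZMod.intCast_zmod_eq_zero_iff_dvd] at h
  obtain ⟨k, hk⟩ := h
  have hp0 : (0 : ℤ) < p := by exact_mod_cast hp.out.pos
  rcases lt_trichotomy k 0 with hk0 | hk0 | hk0
  · have : z.natAbs ≥ p := by
      have h1 : z ≤ -p := by rw [hk]; nlinarith
      omega
    omega
  · subst hk0; simpa using hk
  · have : z.natAbs ≥ p := by
      have h1 : (p : ℤ) ≤ z := by rw [hk]; nlinarith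
      omega
    omega

/-- An integer of absolute value `< p` with `z·g = 0` in `ℤ/pℤ`, `g ≠ 0`, is zero. [folklore] -/
theorem int_eq_zero_of_cast_mul_eq_zero {g : ZMod p} (hg : g ≠ 0) {z : ℤ} (hz : z.natAbs < p)
    (h : (z : ZMod p) * g = 0) : z = 0 :=
  int_eq_zero_of_cast_eq_zero hz ((mul_eq_zero.1 h).resolve_right hg)

/-- **A progression inside a progression has a small commensurable step.**  In `ℤ/pℤ` (`p` prime) let `f, g ≠ 0`, `m ≥ 2`, `2ℓ ≤ p + 1` and
`apFinset a f m ⊆ apFinset b g ℓ`.  Then `f = j·g` for some integer `j ≠ 0` with `(m − 1)·|j| ≤ ℓ − 1`. [cite: Nathanson1996, §2.5] -/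
theorem exists_int_mul_of_apFinset_subset {a b f g : ZMod p} {m ℓ : ℕ} (hf : f ≠ 0) (hg : g ≠ 0) (hm : 2 ≤ m)
    (hℓ : 2 * ℓ ≤ p + 1) (hsub : apFinset a f m ⊆ apFinset b g ℓ) :
    ∃ j : ℤ, f = (j : ZMod p) * g ∧ j ≠ 0 ∧ (m - 1) * j.natAbs ≤ ℓ - 1 := by
  -- positions
  have hmem : ∀ s, s < m → ∃ t, t < ℓ ∧ b + t • g = a + s • f := fun s hs =>
    mem_apFinset.1 (hsub (mem_apFinset.2 ⟨s, hs, rfl⟩))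
  choose! t htl hteq using hmem
  -- consecutive positions: f = (t (s+1) - t s) • g
  have hstep : ∀ s, s + 1 < m → f = (((t (s + 1) : ℤ) - (t s : ℤ) : ℤ) : ZMod p) * g := by
    intro s hs
    have h1 := hteq (s + 1) hs
    have h0 := hteq s (by omega)
    have : f = (a + (s + 1) • f) - (a + s • f) := by rw [succ_nsmul]; abel
    rw [this, ← h1, ← h0]
    push_cast
    simp only [nsmul_eq_mul]
    ring
  obtain ⟨δ, hδ⟩ : ∃ δ : ℤ, δ = (t 1 : ℤ) - (t 0 : ℤ) := ⟨_, rfl⟩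
  have hfδ : f = (δ : ZMod p) * g := by
    have h := hstep 0 (by omega)
    rw [hδ]; push_cast at h ⊢; exact h
  -- all consecutive gaps equal δ
  have hgap : ∀ s, s + 1 < m → ((t (s + 1) : ℤ) - (t s : ℤ)) = δ := by
    intro s hs
    have hs1 := hstep s hs
    have hdiff : ((((t (s + 1) : ℤ) - (t s : ℤ)) - δ : ℤ) : ZMod p) * g = 0 := by
      have h := hs1
      push_cast at h ⊢
      rw [sub_mul, ← h, ← hfδ, sub_self]
    have hb1 := htl (s + 1) hs
    have hb0 := htl s (by omega)
    have hb2 := htl 1 (by omega)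
    have hb3 := htl 0 (by omega)
    have habs : ((((t (s + 1) : ℤ) - (t s : ℤ)) - δ : ℤ)).natAbs < p := by
      rw [hδ]; omega
    have := int_eq_zero_of_cast_mul_eq_zero hg habs hdiff
    omega
  -- positions are an integer progression
  have hpos : ∀ s, s < m → (t s : ℤ) = (t 0 : ℤ) + s * δ := by
    intro s hs
    induction s with
    | zero => simp
    | succ s ih =>
      have h := hgap s hs
      have ih' := ih (by omega)
      push_cast
      linarith
  refine ⟨δ, hfδ, ?_, ?_⟩
  · intro h0
    apply hf
    rw [hfδ, h0]; simp
  · -- (m-1)|δ| ≤ ℓ - 1 from 0 ≤ t 0, t (m-1) < ℓ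
    have hlast := hpos (m - 1) (by omega)
    have hl1 := htl (m - 1) (by omega)
    have hl0 := htl 0 (by omega)
    have hm1 : ((m - 1 : ℕ) : ℤ) = (m : ℤ) - 1 := by omega
    rcases le_or_gt 0 δ with hδ0 | hδ0
    · have : (δ.natAbs : ℤ) = δ := Int.natAbs_of_nonneg hδ0
      have key : ((m : ℤ) - 1) * δ ≤ (ℓ : ℤ) - 1 := by
        have : (t (m - 1) : ℤ) = t 0 + ((m - 1 : ℕ) : ℤ) * δ := hlast
        rw [hm1] at this
        have h2 : (t (m - 1) : ℤ) ≤ ℓ - 1 := by omega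
        have h3 : (0 : ℤ) ≤ t 0 := by omega
        linarith
      have hm' : ((m - 1 : ℕ) : ℤ) * (δ.natAbs : ℤ) ≤ ((ℓ - 1 : ℕ) : ℤ) := by
        rw [hm1, this]
        have : ((ℓ - 1 : ℕ) : ℤ) = (ℓ : ℤ) - 1 := by omega
        rw [this]; exact key
      exact_mod_cast hm'
    · have : (δ.natAbs : ℤ) = -δ := Int.ofNat_natAbs_of_nonpos hδ0.le
      have key : ((m : ℤ) - 1) * (-δ) ≤ (ℓ : ℤ) - 1 := by
        have : (t (m - 1) : ℤ) = t 0 + ((m - 1 : ℕ) : ℤ) * δ := hlast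
        rw [hm1] at this
        have h2 : (0 : ℤ) ≤ t (m - 1) := by omega
        have h3 : (t 0 : ℤ) ≤ ℓ - 1 := by omega
        nlinarith
      have hm' : ((m - 1 : ℕ) : ℤ) * (δ.natAbs : ℤ) ≤ ((ℓ - 1 : ℕ) : ℤ) := by
        rw [hm1, this]
        have : ((ℓ - 1 : ℕ) : ℤ) = (ℓ : ℤ) - 1 := by omega
        rw [this]; exact key
      exact_mod_cast hm'

/-- **Mutual containment forces equal steps up to sign.**  If `apFinset a f m ⊆ apFinset b g ℓ` and `apFinset a′ g m ⊆ apFinset b′ f ℓ` (`f, g ≠ 0`, `m ≥ 2`,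
`2ℓ ≤ p + 1`) and `(ℓ − 1)² < (m − 1)²·(p − 1)`, then `f = g` or `f = −g`. [cite: Nathanson1996, §2.5] -/
theorem eq_or_eq_neg_of_mutual_apFinset_subset {a b a' b' f g : ZMod p} {m ℓ : ℕ} (hf : f ≠ 0) (hg : g ≠ 0) (hm : 2 ≤ m)
    (hℓ : 2 * ℓ ≤ p + 1) (hsub : apFinset a f m ⊆ apFinset b g ℓ) (hsub' : apFinset a' g m ⊆ apFinset b' f ℓ)
    (hsize : (ℓ - 1) * (ℓ - 1) < (m - 1) * (m - 1) * (p - 1)) : f = g ∨ f = -g := by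
  obtain ⟨j, hj, hj0, hjb⟩ := exists_int_mul_of_apFinset_subset hf hg hm hℓ hsub
  obtain ⟨j', hj', hj0', hjb'⟩ := exists_int_mul_of_apFinset_subset hg hf hm hℓ hsub'
  -- f = j j' f, so (j j' - 1) f = 0
  have hprod : (((j * j' - 1 : ℤ)) : ZMod p) * f = 0 := by
    push_cast
    have : f = (j : ZMod p) * ((j' : ZMod p) * f) := by rw [← hj', ← hj]
    linear_combination (-1 : ZMod p) * this
  have hp1 : 1 ≤ p := hp.out.one_le
  have hm1 : 1 ≤ m - 1 := by omega
  -- |j j' - 1| < p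
  have habs : ((j * j' - 1 : ℤ)).natAbs < p := by
    have hb : (m - 1) * j.natAbs * ((m - 1) * j'.natAbs) ≤ (ℓ - 1) * (ℓ - 1) := Nat.mul_le_mul hjb hjb'
    have hb2 : (m - 1) * (m - 1) * (j.natAbs * j'.natAbs) ≤ (ℓ - 1) * (ℓ - 1) := by
      calc (m - 1) * (m - 1) * (j.natAbs * j'.natAbs) = (m - 1) * j.natAbs * ((m - 1) * j'.natAbs) := by ring
        _ ≤ (ℓ - 1) * (ℓ - 1) := hb
    have hb3 : (m - 1) * (m - 1) * (j.natAbs * j'.natAbs) < (m - 1) * (m - 1) * (p - 1) := lt_of_le_of_lt hb2 hsize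
    have hb4 : j.natAbs * j'.natAbs < p - 1 := Nat.lt_of_mul_lt_mul_left hb3
    have : (j * j').natAbs = j.natAbs * j'.natAbs := Int.natAbs_mul j j'
    omega
  have hzero := int_eq_zero_of_cast_mul_eq_zero hf habs hprod
  have hjj : j * j' = 1 := by omega
  rcases Int.eq_one_or_neg_one_of_mul_eq_one hjj with rfl | rfl
  · left; simpa using hj
  · right; simpa using hj

end Summit.MatrixMultiplication.OmegaCensus.CubeNB
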